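import Summits.ValiantsHypothesis.ValiantsHypothesis.Theorems.LacunarySymmetroidMatrixDescartesPivotDeflationNesting

/-!
# `MatrixDescartes` census — DEFLATION PASSAGE LAW for `2 × 2` pivot pencils (pivot column, m = 2)

HONEST FRAMING.  Structure theorems for the object-search cell `pub-symmetroid`'s pivot column
(`…CensusPivotDefs`: `pivotPosRoots`, `PivotRootLawAt`; the open m = 2 row «(2,K) ≤ 2K», located cell
(2,4)₁ ∈ {8,9,10}).  Landed `--supports stmt-ValiantsHypothesis-18050` as a helper; it proves NO bound on any
pivot row and says nothing about `Theses.LacunarySymmetroid.MatrixDescartes`, DoorA26/DoorA34, the census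
registers or `VP ≠ VNP`.

THE LAW.  `F(X) = X^e • J + ∑ₖ X^{d k} • P k` with `J` real symmetric of negative index `≤ 1`
(`J + W Wᵀ ⪰ 0` for some `2 × 1` matrix `W`, exactly as in `PivotRootLawAt m K 1 B`) and all `P k ⪰ 0`.  For a
level `D : ℕ` the DEFLATED pencil is `F̃_D(u) = (D − e) u^e • J + ∑ₖ (D − d k) u^{d k} • P k` (real differences;
`F̃_D(u) = D·F(u) − u F'(u)`; for `D = max d k > e` it is the TOP DEFLATION of `…PivotDeflationNesting` up to the
positive factor `D − e`, a `(K−1)`-letter pivot pencil with positive-semidefinite letters; for `D = min d k < e`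
its NEGATIVE is the BOTTOM DEFLATION up to the factor `e − D`).  The Euler identity
`(vᵀF(u)v / u^D)' = −(vᵀF̃_D(u)v) / u^{D+1}` (`hasDerivAt_quadForm_div_pow`) makes every directional form
`u ↦ vᵀF(u)v / u^D` strictly DECREASING on an interval where `F̃_D ≻ 0` and strictly INCREASING where `F̃_D ≺ 0`
(`quadForm_div_pow_strictAntiOn`, `…_strictMonoOn`).  Consequences, for an open interval `(a, b)`, `0 ≤ a`:

* `top_passage`: if `F̃_D(u) ≻ 0` on `(a, b)` (a GAP of the deflated pencil) and `u₀ ∈ (a, b)` is a root of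
  `det F`, then `det F > 0` on `(a, u₀)` and `det F < 0` on `(u₀, b)` — the root is a DOWN-CROSSING and it is
  the only root in the gap (`top_passage_unique`);
* `bottom_passage`: if `F̃_D(u) ≺ 0` on `(a, b)` then a root `u₀ ∈ (a, b)` has `det F < 0` on `(a, u₀)` and
  `det F > 0` on `(u₀, b)` — an UP-CROSSING, unique in the gap (`bottom_passage_unique`).

So between consecutive islands of the `(K−1)`-letter top (bottom) deflation the `K`-letter determinant has at
most one zero, a down- (up-) crossing: the matrix form of the passage structure of the Rolle/deflation line (desk
R2108), companion of `Deflation.det_deflateTop_neg_of_upcrossing` / `…Bot…`, which place the up- and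
down-crossings INSIDE the deflated islands.  The index hypothesis enters once: two roots in one gap would force
`F(u) ≺ 0`, impossible since `F(u) ⪰ u^e J` has the non-negative direction `W^⊥` (`exists_nonneg_direction`).
No bound on the re-entries of ONE deflated island is claimed (the g5 (2,4) eight-root pencil re-enters its
one-island top deflation four times).

[folklore] Euler's identity for `p(u) / u^D`, the mean value theorem, elementary `2 × 2` definiteness algebra.
-/

-- `Summit.ValiantsHypothesis.ValiantsHypothesis.…` repeats a component by the D-0017 layout
-- (single-conjunct summit), which the `dupNamespace` linter flags; the name is mandated.
set_option linter.dupNamespace false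

namespace Summit.ValiantsHypothesis.ValiantsHypothesis.Theorems.LacunarySymmetroidMatrixDescartes.Pivot.Passage

open Polynomial Matrix Finset
open scoped BigOperators
open Summit.ValiantsHypothesis.ValiantsHypothesis.Theorems.LacunarySymmetroidMatrixDescartes.Pivot.Tangency
open Summit.ValiantsHypothesis.ValiantsHypothesis.Theorems.LacunarySymmetroidMatrixDescartes.Pivot.Deflation

variable {K : ℕ}

/-! ## Elementary `2 × 2` facts -/

/-- A SINGULAR symmetric `[[a,b],[b,c]]` (`a c = b²`) with one strictly negative value is negative
SEMI-definite: all its values are `≤ 0`. [folklore] -/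
theorem quad_nonpos_of_singular_of_neg (a b c x y x' y' : ℝ) (hdet : a * c = b ^ 2)
    (hneg : a * x' ^ 2 + 2 * b * x' * y' + c * y' ^ 2 < 0) :
    a * x ^ 2 + 2 * b * x * y + c * y ^ 2 ≤ 0 := by
  have k1 := singular_form_eq a b c x y hdet
  have k2 := singular_form_eq a b c x' y' hdet
  by_contra h
  rw [not_le] at h
  have h1 : 0 ≤ a + c := by
    by_contra h1
    rw [not_le] at h1
    nlinarith [sq_nonneg (a * x + b * y), sq_nonneg (b * x + c * y), mul_neg_of_neg_of_pos h1 h]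
  have h2 : a + c ≤ 0 := by
    by_contra h2
    rw [not_le] at h2
    nlinarith [sq_nonneg (a * x' + b * y'), sq_nonneg (b * x' + c * y'), mul_neg_of_pos_of_neg h2 hneg]
  have hc : c = -a := by linarith
  have ha : a = 0 := by nlinarith [sq_nonneg b, sq_nonneg a]
  have hb : b = 0 := by
    rw [ha, zero_mul] at hdet
    exact pow_eq_zero_iff (n := 2) (by norm_num) |>.1 hdet.symm
  rw [ha, hb, hc, ha] at h
  simp at h

/-- A symmetric `2 × 2` form that is strictly positive on every non-zero vector has `a c − b² > 0`. [folklore] -/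
theorem det_pos_of_quadForm_pos (a b c : ℝ)
    (h : ∀ x y : ℝ, ¬ (x = 0 ∧ y = 0) → 0 < a * x ^ 2 + 2 * b * x * y + c * y ^ 2) : 0 < a * c - b ^ 2 := by
  have ha : 0 < a := by simpa using h 1 0 (by norm_num)
  have h2 := h b (-a) (fun hh => ha.ne' (neg_eq_zero.1 hh.2))
  have e : a * b ^ 2 + 2 * b * b * -a + c * (-a) ^ 2 = a * (a * c - b ^ 2) := by ring
  rw [e] at h2
  exact (mul_pos_iff_of_pos_left ha).1 h2

/-- A real positive-semidefinite matrix is symmetric. -/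
theorem isSymm_of_posSemidef {n : Type*} {P : Matrix n n ℝ} (hP : P.PosSemidef) : P.IsSymm := by
  have h := hP.isHermitian
  unfold Matrix.IsHermitian at h
  rwa [Matrix.conjTranspose_eq_transpose_of_trivial] at h

/-- **Index `≤ 1` gives a non-negative direction.**  If `J + W Wᵀ ⪰ 0` for a `2 × 1` matrix `W`, then some
non-zero `v` (namely `v ⊥ W`) has `vᵀ J v ≥ 0`. [folklore] -/
theorem exists_nonneg_direction (J : Matrix (Fin 2) (Fin 2) ℝ)
    (hW : ∃ W : Matrix (Fin 2) (Fin 1) ℝ, (J + W * Wᵀ).PosSemidef) :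
    ∃ v : Fin 2 → ℝ, v ≠ 0 ∧ 0 ≤ dotProduct v (J.mulVec v) := by
  obtain ⟨W, hW⟩ := hW
  by_cases h0 : W 0 0 = 0 ∧ W 1 0 = 0
  · refine ⟨![1, 0], by simp, ?_⟩
    have h := hW.dotProduct_mulVec_nonneg ![1, 0]
    simp [Matrix.mulVec, dotProduct, Matrix.mul_apply, Fin.sum_univ_two, h0.1] at h ⊢
    exact h
  · refine ⟨![W 1 0, -(W 0 0)], fun h => h0 ?_, ?_⟩
    · simp at h
      exact ⟨h.2, h.1⟩
    · have h := hW.dotProduct_mulVec_nonneg ![W 1 0, -(W 0 0)]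
      simp [Matrix.mulVec, dotProduct, Matrix.mul_apply, Matrix.add_apply, Fin.sum_univ_two] at h ⊢
      nlinarith [h]

/-- The pencil value `F(u) = u^e • J + ∑ u^{d k} • P k` (`u > 0`, all `P k ⪰ 0`) is non-negative on every
direction on which `J` is non-negative. -/
theorem quadForm_pencil_nonneg_of_dir (e : ℕ) (d : Fin K → ℕ) (J : Matrix (Fin 2) (Fin 2) ℝ)
    (P : Fin K → Matrix (Fin 2) (Fin 2) ℝ) (hP : ∀ k, (P k).PosSemidef) (v : Fin 2 → ℝ)
    (hv : 0 ≤ dotProduct v (J.mulVec v)) {u : ℝ} (hu : 0 < u) :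
    0 ≤ dotProduct v ((u ^ e • J + ∑ k, u ^ d k • P k).mulVec v) := by
  rw [quadForm_comb]
  have hsum : 0 ≤ ∑ k, u ^ d k * dotProduct v ((P k).mulVec v) :=
    Finset.sum_nonneg fun k _ => mul_nonneg (pow_nonneg hu.le _)
      (by simpa only [star_trivial] using (hP k).dotProduct_mulVec_nonneg v)
  have : 0 ≤ u ^ e * dotProduct v (J.mulVec v) := mul_nonneg (pow_nonneg hu.le _) hv
  linarith

/-! ## The Euler identity and monotonicity of the directional forms `vᵀF(u)v / u^D` -/

/-- **Euler identity.**  For `u > 0`,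
`d/du (vᵀF(u)v / u^D) = −(vᵀF̃_D(u)v) / u^{D+1}` with `F̃_D(u) = (D − e) u^e • J + ∑ₖ (D − d k) u^{d k} • P k`
the `D`-deflated pencil. [folklore] -/
theorem hasDerivAt_quadForm_div_pow (e D : ℕ) (d : Fin K → ℕ) (J : Matrix (Fin 2) (Fin 2) ℝ)
    (P : Fin K → Matrix (Fin 2) (Fin 2) ℝ) (v : Fin 2 → ℝ) {u : ℝ} (hu : 0 < u) :
    HasDerivAt (fun u : ℝ => dotProduct v ((u ^ e • J + ∑ k, u ^ d k • P k).mulVec v) / u ^ D)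
      (-(dotProduct v (((((D : ℝ) - e) * u ^ e) • J + ∑ k, (((D : ℝ) - d k) * u ^ d k) • P k).mulVec v))
        / u ^ (D + 1)) u := by
  simp only [quadForm_comb]
  set cJ := dotProduct v (J.mulVec v)
  set c : Fin K → ℝ := fun k => dotProduct v ((P k).mulVec v)
  have hn : HasDerivAt (fun u : ℝ => u ^ e * cJ + ∑ k, u ^ d k * c k)
      ((e : ℝ) * u ^ (e - 1) * cJ + ∑ k, ((d k : ℕ) : ℝ) * u ^ (d k - 1) * c k) u :=
    ((hasDerivAt_pow e u).mul_const cJ).add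
      (HasDerivAt.fun_sum fun k _ => (hasDerivAt_pow (d k) u).mul_const (c k))
  have hD0 : u ^ D ≠ 0 := pow_ne_zero D hu.ne'
  refine (hn.div (hasDerivAt_pow D u) hD0).congr_deriv ?_
  set A := ∑ k, u ^ d k * c k with hA
  set B := ∑ k, ((d k : ℕ) : ℝ) * u ^ d k * c k with hB
  have f1 : u * ∑ k, ((d k : ℕ) : ℝ) * u ^ (d k - 1) * c k = B := by
    rw [hB, Finset.mul_sum]
    refine Finset.sum_congr rfl fun k _ => ?_
    rw [← mul_assoc, SecularRolle.mul_natCast_mul_pow_pred]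
  have f2 : ∑ k, ((D : ℝ) - d k) * u ^ d k * c k = (D : ℝ) * A - B := by
    rw [hA, hB, Finset.mul_sum, ← Finset.sum_sub_distrib]
    exact Finset.sum_congr rfl fun k _ => by ring
  have f3 := SecularRolle.mul_natCast_mul_pow_pred u e
  have f4 := SecularRolle.mul_natCast_mul_pow_pred u D
  rw [div_eq_div_iff (pow_ne_zero _ hD0) (pow_ne_zero _ hu.ne'), f2, pow_succ u D]
  linear_combination (cJ * (u ^ D) ^ 2) * f3 + ((u ^ D) ^ 2) * f1 - ((u ^ e * cJ + A) * u ^ D) * f4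

/-- **Monotonicity on a gap (top type).**  If the `D`-deflated form `vᵀF̃_D(u)v` is strictly positive for all
`u ∈ (a, b)` (`0 ≤ a`), then `u ↦ vᵀF(u)v / u^D` is strictly decreasing on `(a, b)`. -/
theorem quadForm_div_pow_strictAntiOn (e D : ℕ) (d : Fin K → ℕ) (J : Matrix (Fin 2) (Fin 2) ℝ)
    (P : Fin K → Matrix (Fin 2) (Fin 2) ℝ) (v : Fin 2 → ℝ) {a b : ℝ} (ha : 0 ≤ a)
    (hpos : ∀ u ∈ Set.Ioo a b, 0 < dotProduct v (((((D : ℝ) - e) * u ^ e) • J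
        + ∑ k, (((D : ℝ) - d k) * u ^ d k) • P k).mulVec v)) :
    StrictAntiOn (fun u : ℝ => dotProduct v ((u ^ e • J + ∑ k, u ^ d k • P k).mulVec v) / u ^ D)
      (Set.Ioo a b) := by
  refine strictAntiOn_of_deriv_neg (convex_Ioo a b) (fun x hx => ?_) (fun x hx => ?_)
  · exact (hasDerivAt_quadForm_div_pow e D d J P v (ha.trans_lt hx.1)).continuousAt.continuousWithinAt
  · rw [interior_Ioo] at hx
    have hx0 : 0 < x := ha.trans_lt hx.1
    rw [(hasDerivAt_quadForm_div_pow e D d J P v hx0).deriv]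
    exact div_neg_of_neg_of_pos (neg_lt_zero.2 (hpos x hx)) (pow_pos hx0 _)

/-- **Monotonicity on a gap (bottom type).**  If the `D`-deflated form `vᵀF̃_D(u)v` is strictly negative for all
`u ∈ (a, b)` (`0 ≤ a`), then `u ↦ vᵀF(u)v / u^D` is strictly increasing on `(a, b)`. -/
theorem quadForm_div_pow_strictMonoOn (e D : ℕ) (d : Fin K → ℕ) (J : Matrix (Fin 2) (Fin 2) ℝ)
    (P : Fin K → Matrix (Fin 2) (Fin 2) ℝ) (v : Fin 2 → ℝ) {a b : ℝ} (ha : 0 ≤ a)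
    (hneg : ∀ u ∈ Set.Ioo a b, dotProduct v (((((D : ℝ) - e) * u ^ e) • J
        + ∑ k, (((D : ℝ) - d k) * u ^ d k) • P k).mulVec v) < 0) :
    StrictMonoOn (fun u : ℝ => dotProduct v ((u ^ e • J + ∑ k, u ^ d k • P k).mulVec v) / u ^ D)
      (Set.Ioo a b) := by
  refine strictMonoOn_of_deriv_pos (convex_Ioo a b) (fun x hx => ?_) (fun x hx => ?_)
  · exact (hasDerivAt_quadForm_div_pow e D d J P v (ha.trans_lt hx.1)).continuousAt.continuousWithinAt
  · rw [interior_Ioo] at hx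
    have hx0 : 0 < x := ha.trans_lt hx.1
    rw [(hasDerivAt_quadForm_div_pow e D d J P v hx0).deriv]
    exact div_pos (neg_pos.2 (hneg x hx)) (pow_pos hx0 _)

/-! ## Sign transport along a gap -/

/-- From `q(u')/u'^D < q(u)/u^D` (`u, u' > 0`): `q(u) ≤ 0 ⟹ q(u') < 0`. -/
theorem neg_of_div_pow_lt_of_nonpos {q q' u u' : ℝ} {D : ℕ} (hu : 0 < u) (hu' : 0 < u')
    (hlt : q' / u' ^ D < q / u ^ D) (hq : q ≤ 0) : q' < 0 :=
  lt_of_not_ge fun h => absurd (hlt.trans_le (div_nonpos_of_nonpos_of_nonneg hq (pow_nonneg hu.le _)))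
    (not_lt.2 (div_nonneg h (pow_nonneg hu'.le _)))

/-- From `q(u')/u'^D < q(u)/u^D` (`u, u' > 0`): `0 ≤ q(u') ⟹ 0 < q(u)`. -/
theorem pos_of_div_pow_lt_of_nonneg {q q' u u' : ℝ} {D : ℕ} (hu : 0 < u) (hu' : 0 < u')
    (hlt : q' / u' ^ D < q / u ^ D) (hq' : 0 ≤ q') : 0 < q :=
  lt_of_not_ge fun h => absurd ((div_nonneg hq' (pow_nonneg hu'.le _)).trans_lt hlt)
    (not_lt.2 (div_nonpos_of_nonpos_of_nonneg h (pow_nonneg hu.le _)))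

/-! ## The passage law -/

/-- **Step B (shared).**  `J` symmetric of negative index `≤ 1`, all `P k ⪰ 0`, `0 ≤ a`.  If every point `u` of
`(a, b)` has a COMPANION `u' ∈ (a, b)` at which all directional forms `vᵀF(·)v/·^D` (`v ≠ 0`) are strictly
smaller than at `u`, then every point of `(a, b)` carries a strictly positive direction of `F(u)` (otherwise
`F(u') ≺ 0`, impossible by `exists_nonneg_direction`). -/
theorem exists_pos_direction (e D : ℕ) (d : Fin K → ℕ) (J : Matrix (Fin 2) (Fin 2) ℝ)
    (P : Fin K → Matrix (Fin 2) (Fin 2) ℝ) (hP : ∀ k, (P k).PosSemidef)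
    (hW : ∃ W : Matrix (Fin 2) (Fin 1) ℝ, (J + W * Wᵀ).PosSemidef) {a b : ℝ} (ha : 0 ≤ a)
    (hB : ∀ u ∈ Set.Ioo a b, ∃ u' ∈ Set.Ioo a b, ∀ v : Fin 2 → ℝ, v ≠ 0 →
      dotProduct v ((u' ^ e • J + ∑ k, u' ^ d k • P k).mulVec v) / u' ^ D
        < dotProduct v ((u ^ e • J + ∑ k, u ^ d k • P k).mulVec v) / u ^ D)
    {u : ℝ} (hu : u ∈ Set.Ioo a b) :
    ∃ v : Fin 2 → ℝ, v ≠ 0 ∧ 0 < dotProduct v ((u ^ e • J + ∑ k, u ^ d k • P k).mulVec v) := by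
  obtain ⟨w, hw0, hwJ⟩ := exists_nonneg_direction J hW
  by_contra hcon
  push Not at hcon
  obtain ⟨u', hu', hlt⟩ := hB u hu
  have := neg_of_div_pow_lt_of_nonpos (ha.trans_lt hu.1) (ha.trans_lt hu'.1) (hlt w hw0) (hcon w hw0)
  exact absurd (quadForm_pencil_nonneg_of_dir e d J P hP w hwJ (ha.trans_lt hu'.1)) (not_le.2 this)

/-- **Step C (shared).**  Under the hypotheses of `exists_pos_direction`, at a root `u₀ ∈ (a, b)` of `det F`
the value `F(u₀)` is positive SEMI-definite (a singular `2 × 2` matrix with a negative direction would be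
negative semi-definite, contradicting Step B). -/
theorem nonneg_at_root (e D : ℕ) (d : Fin K → ℕ) (J : Matrix (Fin 2) (Fin 2) ℝ)
    (P : Fin K → Matrix (Fin 2) (Fin 2) ℝ) (hJ : J.IsSymm) (hP : ∀ k, (P k).PosSemidef)
    (hW : ∃ W : Matrix (Fin 2) (Fin 1) ℝ, (J + W * Wᵀ).PosSemidef) {a b : ℝ} (ha : 0 ≤ a)
    (hB : ∀ u ∈ Set.Ioo a b, ∃ u' ∈ Set.Ioo a b, ∀ v : Fin 2 → ℝ, v ≠ 0 →
      dotProduct v ((u' ^ e • J + ∑ k, u' ^ d k • P k).mulVec v) / u' ^ D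
        < dotProduct v ((u ^ e • J + ∑ k, u ^ d k • P k).mulVec v) / u ^ D)
    {u₀ : ℝ} (hu₀ : u₀ ∈ Set.Ioo a b)
    (hroot : (Matrix.det (((Polynomial.X : ℝ[X]) ^ e) • Matrix.map J Polynomial.C
          + ∑ k, ((Polynomial.X : ℝ[X]) ^ d k) • Matrix.map (P k) Polynomial.C)).eval u₀ = 0)
    (v : Fin 2 → ℝ) : 0 ≤ dotProduct v ((u₀ ^ e • J + ∑ k, u₀ ^ d k • P k).mulVec v) := by
  have hPs : ∀ k, (P k).IsSymm := fun k => isSymm_of_posSemidef (hP k)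
  have hsym := comb_symm (u₀ ^ e) (fun k => u₀ ^ d k) J P hJ hPs
  by_contra hcon
  rw [not_le, quadForm_fin_two _ hsym] at hcon
  obtain ⟨v', _, hv'⟩ := exists_pos_direction e D d J P hP hW ha hB hu₀
  rw [quadForm_fin_two _ hsym] at hv'
  have hsing : (u₀ ^ e • J + ∑ k, u₀ ^ d k • P k) 0 0 * (u₀ ^ e • J + ∑ k, u₀ ^ d k • P k) 1 1
      = (u₀ ^ e • J + ∑ k, u₀ ^ d k • P k) 0 1 ^ 2 := by
    have := eval_det_pencil e d J P u₀
    rw [hroot, hsym] at this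
    linarith
  have := quad_nonpos_of_singular_of_neg _ _ _ (v' 0) (v' 1) (v 0) (v 1) hsing hcon
  linarith

/-- **TOP PASSAGE LAW.**  `J` symmetric with `J + W Wᵀ ⪰ 0` for some `2 × 1` matrix `W` (negative index
`≤ 1`), all `P k ⪰ 0`, `0 ≤ a`, and on the open interval `(a, b)` the `D`-deflated pencil
`F̃_D(u) = (D − e) u^e • J + ∑ₖ (D − d k) u^{d k} • P k` is positive definite (a GAP of the deflated pencil).
If `u₀ ∈ (a, b)` is a root of `det F`, `F(X) = X^e • J + ∑ₖ X^{d k} • P k`, then `det F > 0` on `(a, u₀)` and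
`det F < 0` on `(u₀, b)`: the root is a down-crossing and the only root in the gap. [folklore mechanism:
`u^{−D}F(u)` is Loewner-decreasing on the gap; two zeros would force `F ≺ 0`] -/
theorem top_passage (e D : ℕ) (d : Fin K → ℕ) (J : Matrix (Fin 2) (Fin 2) ℝ)
    (P : Fin K → Matrix (Fin 2) (Fin 2) ℝ) (hJ : J.IsSymm) (hP : ∀ k, (P k).PosSemidef)
    (hW : ∃ W : Matrix (Fin 2) (Fin 1) ℝ, (J + W * Wᵀ).PosSemidef) {a b : ℝ} (ha : 0 ≤ a)
    (hgap : ∀ u ∈ Set.Ioo a b, ∀ v : Fin 2 → ℝ, v ≠ 0 → 0 < dotProduct v (((((D : ℝ) - e) * u ^ e) • J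
        + ∑ k, (((D : ℝ) - d k) * u ^ d k) • P k).mulVec v))
    {u₀ : ℝ} (hu₀ : u₀ ∈ Set.Ioo a b)
    (hroot : (Matrix.det (((Polynomial.X : ℝ[X]) ^ e) • Matrix.map J Polynomial.C
          + ∑ k, ((Polynomial.X : ℝ[X]) ^ d k) • Matrix.map (P k) Polynomial.C)).eval u₀ = 0) :
    (∀ u ∈ Set.Ioo a u₀, 0 < (Matrix.det (((Polynomial.X : ℝ[X]) ^ e) • Matrix.map J Polynomial.C
          + ∑ k, ((Polynomial.X : ℝ[X]) ^ d k) • Matrix.map (P k) Polynomial.C)).eval u) ∧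
    (∀ u ∈ Set.Ioo u₀ b, (Matrix.det (((Polynomial.X : ℝ[X]) ^ e) • Matrix.map J Polynomial.C
          + ∑ k, ((Polynomial.X : ℝ[X]) ^ d k) • Matrix.map (P k) Polynomial.C)).eval u < 0) := by
  have hPs : ∀ k, (P k).IsSymm := fun k => isSymm_of_posSemidef (hP k)
  have hsym : ∀ u : ℝ, (u ^ e • J + ∑ k, u ^ d k • P k) 1 0 = (u ^ e • J + ∑ k, u ^ d k • P k) 0 1 :=
    fun u => comb_symm (u ^ e) (fun k => u ^ d k) J P hJ hPs
  have hanti : ∀ v : Fin 2 → ℝ, v ≠ 0 → StrictAntiOn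
      (fun u : ℝ => dotProduct v ((u ^ e • J + ∑ k, u ^ d k • P k).mulVec v) / u ^ D) (Set.Ioo a b) :=
    fun v hv => quadForm_div_pow_strictAntiOn e D d J P v ha (fun u hu => hgap u hu v hv)
  -- companion of `u`: the midpoint of `(u, b)`
  have hB : ∀ u ∈ Set.Ioo a b, ∃ u' ∈ Set.Ioo a b, ∀ v : Fin 2 → ℝ, v ≠ 0 →
      dotProduct v ((u' ^ e • J + ∑ k, u' ^ d k • P k).mulVec v) / u' ^ D
        < dotProduct v ((u ^ e • J + ∑ k, u ^ d k • P k).mulVec v) / u ^ D := fun u hu =>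
    ⟨(u + b) / 2, ⟨by linarith [hu.1, hu.2], by linarith [hu.2]⟩,
      fun v hv => hanti v hv hu ⟨by linarith [hu.1, hu.2], by linarith [hu.2]⟩ (by linarith [hu.2])⟩
  have hu₀0 : 0 < u₀ := ha.trans_lt hu₀.1
  refine ⟨fun u hu => ?_, fun u hu => ?_⟩
  · -- before the root: every non-zero direction is strictly positive, so `det > 0`
    have hu0 : 0 < u := ha.trans_lt hu.1
    rw [eval_det_pencil, hsym u, ← sq]
    refine det_pos_of_quadForm_pos _ _ _ fun x y hxy => ?_
    have hv : (![x, y] : Fin 2 → ℝ) ≠ 0 := fun h => hxy ⟨by simpa using congrFun h 0, by simpa using congrFun h 1⟩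
    have key := pos_of_div_pow_lt_of_nonneg hu0 hu₀0 (hanti _ hv ⟨hu.1, hu.2.trans hu₀.2⟩ hu₀ hu.2)
      (nonneg_at_root e D d J P hJ hP hW ha hB hu₀ hroot ![x, y])
    rw [quadForm_fin_two _ (hsym u)] at key
    simpa using key
  · -- after the root: the kernel direction is strictly negative, some direction strictly positive
    have hu0 : 0 < u := ha.trans_lt (hu₀.1.trans hu.1)
    have humem : u ∈ Set.Ioo a b := ⟨hu₀.1.trans hu.1, hu.2⟩
    have hdet0 : (u₀ ^ e • J + ∑ k, u₀ ^ d k • P k).det = 0 := by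
      rw [Matrix.det_fin_two, hsym u₀]
      have := eval_det_pencil e d J P u₀; rw [hroot, hsym u₀] at this; linarith
    obtain ⟨v₀, hv₀0, hv₀⟩ := Matrix.exists_mulVec_eq_zero_iff.2 hdet0
    have hneg := neg_of_div_pow_lt_of_nonpos hu₀0 hu0 (hanti _ hv₀0 hu₀ humem hu.1)
      (by rw [hv₀, dotProduct_zero])
    obtain ⟨vp, _, hpos⟩ := exists_pos_direction e D d J P hP hW ha hB humem
    rw [quadForm_fin_two _ (hsym u)] at hneg hpos
    rw [eval_det_pencil, hsym u, ← sq]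
    exact det_neg_of_pos_of_neg _ _ _ _ _ _ _ hpos hneg

/-- **TOP PASSAGE LAW — uniqueness.**  Under the hypotheses of `top_passage`, two roots of `det F` in the gap
`(a, b)` coincide: a gap of the top deflation carries at most one root. -/
theorem top_passage_unique (e D : ℕ) (d : Fin K → ℕ) (J : Matrix (Fin 2) (Fin 2) ℝ)
    (P : Fin K → Matrix (Fin 2) (Fin 2) ℝ) (hJ : J.IsSymm) (hP : ∀ k, (P k).PosSemidef)
    (hW : ∃ W : Matrix (Fin 2) (Fin 1) ℝ, (J + W * Wᵀ).PosSemidef) {a b : ℝ} (ha : 0 ≤ a)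
    (hgap : ∀ u ∈ Set.Ioo a b, ∀ v : Fin 2 → ℝ, v ≠ 0 → 0 < dotProduct v (((((D : ℝ) - e) * u ^ e) • J
        + ∑ k, (((D : ℝ) - d k) * u ^ d k) • P k).mulVec v))
    {u₀ u₁ : ℝ} (hu₀ : u₀ ∈ Set.Ioo a b) (hu₁ : u₁ ∈ Set.Ioo a b)
    (hr₀ : (Matrix.det (((Polynomial.X : ℝ[X]) ^ e) • Matrix.map J Polynomial.C
          + ∑ k, ((Polynomial.X : ℝ[X]) ^ d k) • Matrix.map (P k) Polynomial.C)).eval u₀ = 0)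
    (hr₁ : (Matrix.det (((Polynomial.X : ℝ[X]) ^ e) • Matrix.map J Polynomial.C
          + ∑ k, ((Polynomial.X : ℝ[X]) ^ d k) • Matrix.map (P k) Polynomial.C)).eval u₁ = 0) :
    u₀ = u₁ := by
  rcases lt_trichotomy u₀ u₁ with h | h | h
  · have := (top_passage e D d J P hJ hP hW ha hgap hu₀ hr₀).2 u₁ ⟨h, hu₁.2⟩
    rw [hr₁] at this; exact absurd this (lt_irrefl 0)
  · exact h
  · have := (top_passage e D d J P hJ hP hW ha hgap hu₁ hr₁).2 u₀ ⟨h, hu₀.2⟩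
    rw [hr₀] at this; exact absurd this (lt_irrefl 0)

/-- **BOTTOM PASSAGE LAW.**  Same setting, but on `(a, b)` the `D`-deflated pencil `F̃_D` is NEGATIVE definite
(for `D = min d k < e` this says that the bottom-deflated `(K−1)`-letter pivot pencil
`(e − D) u^e • J + ∑ (d k − D) u^{d k} • P k = −F̃_D` is positive definite: a gap of the bottom deflation).
A root `u₀ ∈ (a, b)` of `det F` has `det F < 0` on `(a, u₀)` and `det F > 0` on `(u₀, b)`: an up-crossing,
the only root in the gap. [folklore mechanism: `u^{−D}F(u)` is Loewner-increasing on the gap] -/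
theorem bottom_passage (e D : ℕ) (d : Fin K → ℕ) (J : Matrix (Fin 2) (Fin 2) ℝ)
    (P : Fin K → Matrix (Fin 2) (Fin 2) ℝ) (hJ : J.IsSymm) (hP : ∀ k, (P k).PosSemidef)
    (hW : ∃ W : Matrix (Fin 2) (Fin 1) ℝ, (J + W * Wᵀ).PosSemidef) {a b : ℝ} (ha : 0 ≤ a)
    (hgap : ∀ u ∈ Set.Ioo a b, ∀ v : Fin 2 → ℝ, v ≠ 0 → dotProduct v (((((D : ℝ) - e) * u ^ e) • J
        + ∑ k, (((D : ℝ) - d k) * u ^ d k) • P k).mulVec v) < 0)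
    {u₀ : ℝ} (hu₀ : u₀ ∈ Set.Ioo a b)
    (hroot : (Matrix.det (((Polynomial.X : ℝ[X]) ^ e) • Matrix.map J Polynomial.C
          + ∑ k, ((Polynomial.X : ℝ[X]) ^ d k) • Matrix.map (P k) Polynomial.C)).eval u₀ = 0) :
    (∀ u ∈ Set.Ioo a u₀, (Matrix.det (((Polynomial.X : ℝ[X]) ^ e) • Matrix.map J Polynomial.C
          + ∑ k, ((Polynomial.X : ℝ[X]) ^ d k) • Matrix.map (P k) Polynomial.C)).eval u < 0) ∧
    (∀ u ∈ Set.Ioo u₀ b, 0 < (Matrix.det (((Polynomial.X : ℝ[X]) ^ e) • Matrix.map J Polynomial.C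
          + ∑ k, ((Polynomial.X : ℝ[X]) ^ d k) • Matrix.map (P k) Polynomial.C)).eval u) := by
  have hPs : ∀ k, (P k).IsSymm := fun k => isSymm_of_posSemidef (hP k)
  have hsym : ∀ u : ℝ, (u ^ e • J + ∑ k, u ^ d k • P k) 1 0 = (u ^ e • J + ∑ k, u ^ d k • P k) 0 1 :=
    fun u => comb_symm (u ^ e) (fun k => u ^ d k) J P hJ hPs
  have hmono : ∀ v : Fin 2 → ℝ, v ≠ 0 → StrictMonoOn
      (fun u : ℝ => dotProduct v ((u ^ e • J + ∑ k, u ^ d k • P k).mulVec v) / u ^ D) (Set.Ioo a b) :=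
    fun v hv => quadForm_div_pow_strictMonoOn e D d J P v ha (fun u hu => hgap u hu v hv)
  -- companion of `u`: the midpoint of `(a, u)`
  have hB : ∀ u ∈ Set.Ioo a b, ∃ u' ∈ Set.Ioo a b, ∀ v : Fin 2 → ℝ, v ≠ 0 →
      dotProduct v ((u' ^ e • J + ∑ k, u' ^ d k • P k).mulVec v) / u' ^ D
        < dotProduct v ((u ^ e • J + ∑ k, u ^ d k • P k).mulVec v) / u ^ D := fun u hu =>
    ⟨(a + u) / 2, ⟨by linarith [hu.1], by linarith [hu.1, hu.2]⟩,
      fun v hv => hmono v hv ⟨by linarith [hu.1], by linarith [hu.1, hu.2]⟩ hu (by linarith [hu.1])⟩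
  have hu₀0 : 0 < u₀ := ha.trans_lt hu₀.1
  refine ⟨fun u hu => ?_, fun u hu => ?_⟩
  · -- before the root: the kernel direction is strictly negative, some direction strictly positive
    have hu0 : 0 < u := ha.trans_lt hu.1
    have humem : u ∈ Set.Ioo a b := ⟨hu.1, hu.2.trans hu₀.2⟩
    have hdet0 : (u₀ ^ e • J + ∑ k, u₀ ^ d k • P k).det = 0 := by
      rw [Matrix.det_fin_two, hsym u₀]
      have := eval_det_pencil e d J P u₀; rw [hroot, hsym u₀] at this; linarith
    obtain ⟨v₀, hv₀0, hv₀⟩ := Matrix.exists_mulVec_eq_zero_iff.2 hdet0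
    have hneg := neg_of_div_pow_lt_of_nonpos hu₀0 hu0 (hmono _ hv₀0 humem hu₀ hu.2)
      (by rw [hv₀, dotProduct_zero])
    obtain ⟨vp, _, hpos⟩ := exists_pos_direction e D d J P hP hW ha hB humem
    rw [quadForm_fin_two _ (hsym u)] at hneg hpos
    rw [eval_det_pencil, hsym u, ← sq]
    exact det_neg_of_pos_of_neg _ _ _ _ _ _ _ hpos hneg
  · -- after the root: every non-zero direction strictly positive
    have hu0 : 0 < u := ha.trans_lt (hu₀.1.trans hu.1)
    rw [eval_det_pencil, hsym u, ← sq]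
    refine det_pos_of_quadForm_pos _ _ _ fun x y hxy => ?_
    have hv : (![x, y] : Fin 2 → ℝ) ≠ 0 := fun h => hxy ⟨by simpa using congrFun h 0, by simpa using congrFun h 1⟩
    have key := pos_of_div_pow_lt_of_nonneg hu0 hu₀0 (hmono _ hv hu₀ ⟨hu₀.1.trans hu.1, hu.2⟩ hu.1)
      (nonneg_at_root e D d J P hJ hP hW ha hB hu₀ hroot ![x, y])
    rw [quadForm_fin_two _ (hsym u)] at key
    simpa using key

/-- **BOTTOM PASSAGE LAW — uniqueness.**  Two roots of `det F` in a gap of the bottom type coincide. -/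
theorem bottom_passage_unique (e D : ℕ) (d : Fin K → ℕ) (J : Matrix (Fin 2) (Fin 2) ℝ)
    (P : Fin K → Matrix (Fin 2) (Fin 2) ℝ) (hJ : J.IsSymm) (hP : ∀ k, (P k).PosSemidef)
    (hW : ∃ W : Matrix (Fin 2) (Fin 1) ℝ, (J + W * Wᵀ).PosSemidef) {a b : ℝ} (ha : 0 ≤ a)
    (hgap : ∀ u ∈ Set.Ioo a b, ∀ v : Fin 2 → ℝ, v ≠ 0 → dotProduct v (((((D : ℝ) - e) * u ^ e) • J
        + ∑ k, (((D : ℝ) - d k) * u ^ d k) • P k).mulVec v) < 0)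
    {u₀ u₁ : ℝ} (hu₀ : u₀ ∈ Set.Ioo a b) (hu₁ : u₁ ∈ Set.Ioo a b)
    (hr₀ : (Matrix.det (((Polynomial.X : ℝ[X]) ^ e) • Matrix.map J Polynomial.C
          + ∑ k, ((Polynomial.X : ℝ[X]) ^ d k) • Matrix.map (P k) Polynomial.C)).eval u₀ = 0)
    (hr₁ : (Matrix.det (((Polynomial.X : ℝ[X]) ^ e) • Matrix.map J Polynomial.C
          + ∑ k, ((Polynomial.X : ℝ[X]) ^ d k) • Matrix.map (P k) Polynomial.C)).eval u₁ = 0) :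
    u₀ = u₁ := by
  rcases lt_trichotomy u₀ u₁ with h | h | h
  · have := (bottom_passage e D d J P hJ hP hW ha hgap hu₁ hr₁).1 u₀ ⟨hu₀.1, h⟩
    rw [hr₀] at this; exact absurd this (lt_irrefl 0)
  · exact h
  · have := (bottom_passage e D d J P hJ hP hW ha hgap hu₀ hr₀).1 u₁ ⟨hu₁.1, h⟩
    rw [hr₁] at this; exact absurd this (lt_irrefl 0)

end Summit.ValiantsHypothesis.ValiantsHypothesis.Theorems.LacunarySymmetroidMatrixDescartes.Pivot.Passage
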